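import Literature.AlgebraicGeometry.HodgeTheory.CompleteIntersectionHilbertFunction
import Literature.AlgebraicGeometry.HodgeTheory.CompleteIntersectionCycleIdeal
import Literature.AlgebraicGeometry.Kloosterman2023.CompleteIntersectionHodgeLoci
import HarnessLib

/-!
# The codimension of the tangent space to the Hodge locus of a complete-intersection class is `h_I(e)`
# (Kloosterman 2023, Prop. 3.2 / Prop. 4.13 — algebraic form), and `h_I = ciHilbert`

Topic `Literature/AlgebraicGeometry/HodgeTheory`. R. Kloosterman, *Variational Hodge conjecture for complete
intersections on hypersurfaces in projective space*, Rend. Sem. Mat. Univ. Padova 148 (2023) 185–201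
(arXiv:2104.14845). §2, eq. (1): the Hilbert function `h_I(m) = dim (S/I)_m` of a complete intersection ideal is
given by the Koszul formula, so it depends only on the degrees of the generators. **Prop. 4.13**: "Suppose
`Y ⊂ 𝐏^{2k+1}` is a smooth hypersurface of degree `e`, containing a complete intersection `Z` of multidegree
`(d₁,…,d_{k+1})`, with `1 ≤ dᵢ ≤ e−1` … Let `I` be any complete intersection ideal of multidegree
`(d₁,…,d_{k+1},e−d_{k+1},…,e−d₁)`. Then the codimension in `S_e` of the tangent space to `NL([Z]_prim)` at `Y`
equals `h_I(e)`." (Prop. 3.2: the locus `L(d₁,…,d_{k+1};e)` of hypersurfaces containing such a complete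
intersection has the same codimension `h_I(e)`; Thm. 4.14: hence `NL([Z]_prim)` is that locus near `Y`.)
H. Movasati, *Why should one compute periods of algebraic cycles?* (arXiv:1602.06607), §6: the numbers
`C_{a₁,…,a_t} := dim (ℂ[x]/⟨regular sequence of degrees aᵢ⟩)_d`.

The tree file `Kloosterman2023/CompleteIntersectionHodgeLoci.lean` names the printed quantity as the computable
box count `ciHilbert a m = #{α ∈ ℕ^t : Σ αᵢ = m, αᵢ < aᵢ}` and checks the printed tables by `decide`, with NO
geometry. **This file supplies the algebra behind those tables (0 facts, 0 sorry; any field `K`):**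

* `card_filter_finsuppAntidiag_eq_ciHilbert` — the box count of `CompleteIntersectionHilbertFunction.lean` IS
  `ciHilbert`: `#{β : |β| = t, βᵢ ≤ aᵢ − 1} = ciHilbert [a₀, …, a_{m−1}] t` (`aᵢ ≥ 1`);
* `hilbert_span_eq_ciHilbert` — **`h_I = ciHilbert` for every Artinian complete intersection**: for `m` forms
  `G_i` of positive degrees `d_i` in `m` variables with a power of every variable in `(G)`,
  `dim_K (S/(G))_t = ciHilbert [d₀, …, d_{m−1}] t` (eq. (1)'s "depends only on the degrees", from
  `hilbert_span_eq_card_of_degrees`); in particular `ciHilbert` of a list of positive integers is invariant under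
  permutations (`ciHilbert_ofFn_comp_equiv`), Gorenstein-symmetric about `Σ (a_i − 1)/2` (`ciHilbert_ofFn_symm`),
  positive exactly up to the socle degree `Σ (a_i − 1)` where it is `1` (`ciHilbert_ofFn_pos_iff`,
  `ciHilbert_ofFn_socle`; Cor. 6.20 (i) for every Artinian Gorenstein ideal: `IsArtinianGorenstein.hilbert_pos_iff`),
  and `dim R^F_a = ciHilbert [d−1, …, d−1] a` for every form `F` with
  finite-dimensional Jacobian ring (`hilbert_jacobianIdeal_eq_ciHilbert_of_finite`, Movasati's `#I_a`);
* `hilbert_jacobianIdeal_colon_det_eq_ciHilbert` — **Prop. 4.13 in algebraic form**: for `F = Σ_{i=0}^{k} f_i g_i`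
  in `2k+2` variables (`f_i`, `g_i` forms of positive degrees `a_i + b_i = d`) with finite-dimensional Jacobian
  ring, and `D = det(∂(g,f)/∂x)` the transition determinant (`CompleteIntersectionCycleIdeal.lean`:
  `(J^F : D) = (f) + (g)`), the codimension of `(J^F : D)_t` in `S_t` is `ciHilbert (a ++ b) t` for every `t`;
  at `t = d` this is the printed "codimension in `S_e` of the tangent space to `NL([Z]_prim)` equals `h_I(e)`",
  granted the identification `[Z]_prim ↔ c·D` (Villaflor 2022, Thm. 1) and `T NL = (J^{F,λ})_e` (the tree's
  Hodge-locus dictionary), which are cited, not formalised;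
* `hilbert_jacobianIdeal_colon_det_quarticFourfold_ci112` — the census instance: every quartic fourfold with
  finite-dimensional Jacobian ring presented as `F = f₀g₀ + f₁g₁ + f₂g₂` through a complete intersection of type
  `(1,1,2)` has `codim_{S_4} (J^F : D)_4 = 8` (Movasati: "`Σ_{1,1,2}` has codimension `8`"; tree
  `movasati_quarticFourfold_sigma112`); likewise the other complete-intersection rows of the pub-hlocus census
  (tree `census_ci_rows`): quartic fourfold `(1,2,2)`: `11`; quintic fourfold `(1,1,2)`: `19`; cubic sixfold
  `(1,1,1,2)`: `4`; quartic sixfold `(2,2,1,1)`: `36`; quartic eightfold `(2,2,1,1,1)`: `83` — now for EVERY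
  smooth hypersurface through such a complete intersection, not only at the Fermat point.

HONEST FRAMING (cell pub-hlocus): certified instances and evidence bearing on the general Hodge conjecture; no
claim.

## References

* [Kloosterman2023] R. Kloosterman, *Variational Hodge conjecture for complete intersections on hypersurfaces in
  projective space*, Rend. Sem. Mat. Univ. Padova 148 (2023), §2 eq. (1), Prop. 3.2, Prop. 4.13, Thm. 4.14.
* [Movasati2016Periods] H. Movasati, *Why should one compute periods of algebraic cycles?*, arXiv:1602.06607, §6.
* [Villaflorloyola2021] R. Villaflor Loyola, *Small codimension components of the Hodge locus containing the
  Fermat variety*, Commun. Contemp. Math. 24 (2022), Example 2.1.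
* [Villaflor2022PeriodsCI] R. Villaflor Loyola, *Periods of complete intersection algebraic cycles*, manuscripta
  math. 167 (2022), Thm. 1.
* [VoisinHodgeII2003] C. Voisin, *Hodge Theory and Complex Algebraic Geometry II*, CUP 2003, Thm. 6.19,
  Cor. 6.20 (i).
* [DuqueFrancoVillaflor2025Join] J. Duque Franco, R. Villaflor Loyola, *Hodge loci associated with linear
  subspaces intersecting in codimension one* (arXiv:2312.17222), Definition 2.1.
-/

noncomputable section

open MvPolynomial Module
open Literature.RingTheory.MvPolynomial Literature.AlgebraicGeometry.DuqueFrancoVillaflor2025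
  Literature.AlgebraicGeometry.Kloosterman2023

attribute [local instance] MvPolynomial.gradedAlgebra

namespace Literature.AlgebraicGeometry.HodgeTheory

universe u

variable {K : Type u} [Field K] {m : ℕ}

/-! ### The box count is `ciHilbert` -/

/-- List sums over `List.range` are `Finset.range` sums. [folklore] -/
private theorem sum_map_range_eq (n : ℕ) (φ : ℕ → ℕ) :
    ((List.range n).map φ).sum = ∑ j ∈ Finset.range n, φ j := by
  induction n with
  | zero => simp
  | succ n ih =>
    rw [List.range_succ, List.map_append, List.sum_append, ih, Finset.sum_range_succ]
    simp

/-- The box count in no variables. [folklore] -/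
private theorem card_box_zero (a : Fin 0 → ℕ) (t : ℕ) :
    ((Finset.univ.finsuppAntidiag t).filter fun β : Fin 0 →₀ ℕ => ∀ i, β i ≤ a i - 1).card =
      if t = 0 then 1 else 0 := by
  rw [Finset.filter_true_of_mem (fun β _ i => i.elim0), Finset.univ_eq_empty, Finset.finsuppAntidiag_empty]
  split_ifs <;> simp

/-- Peeling off the first variable: `#A(a₀, …, a_m; t) = Σ_{j < a₀, j ≤ t} #A(a₁, …, a_m; t − j)`. [folklore] -/
private theorem card_box_succ (a : Fin (m + 1) → ℕ) (ha : 0 < a 0) (t : ℕ) :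
    ((Finset.univ.finsuppAntidiag t).filter fun β : Fin (m + 1) →₀ ℕ => ∀ i, β i ≤ a i - 1).card =
      ∑ j ∈ Finset.range (a 0), if j ≤ t then
        ((Finset.univ.finsuppAntidiag (t - j)).filter fun β : Fin m →₀ ℕ => ∀ i, β i ≤ a i.succ - 1).card
        else 0 := by
  have hmem : ∀ (n : ℕ) (s : ℕ) (c : Fin n → ℕ) (β : Fin n →₀ ℕ),
      β ∈ ((Finset.univ.finsuppAntidiag s).filter fun β : Fin n →₀ ℕ => ∀ i, β i ≤ c i - 1) ↔
        (∑ i, β i = s) ∧ ∀ i, β i ≤ c i - 1 := by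
    intro n s c β
    simp only [Finset.mem_filter, Finset.mem_finsuppAntidiag, Finset.subset_univ, and_true]
  rw [Finset.card_eq_sum_card_fiberwise (f := fun β : Fin (m + 1) →₀ ℕ => β 0) (t := Finset.range (a 0))
    (fun β hβ => by
      have h := ((hmem _ _ _ β).mp hβ).2 0
      simp only [Finset.coe_range, Set.mem_Iio]
      omega)]
  refine Finset.sum_congr rfl fun j hj => ?_
  have hja : j < a 0 := Finset.mem_range.mp hj
  split_ifs with hjt
  · refine Finset.card_nbij' (fun β => Finsupp.tail β) (fun β' => Finsupp.cons j β') (fun β hβ => ?_)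
      (fun β' hβ' => ?_) (fun β hβ => ?_) (fun β' _ => Finsupp.tail_cons _ _)
    · rw [Finset.coe_filter, Set.mem_setOf_eq] at hβ
      obtain ⟨hβ, hβ0⟩ := hβ
      obtain ⟨hsum, hle⟩ := (hmem _ _ _ β).mp hβ
      rw [Finset.mem_coe, hmem]
      refine ⟨?_, fun i => by rw [Finsupp.tail_apply]; exact hle i.succ⟩
      rw [Fin.sum_univ_succ, hβ0] at hsum
      simp only [Finsupp.tail_apply]
      omega
    · rw [Finset.mem_coe, hmem] at hβ'
      obtain ⟨hsum, hle⟩ := hβ'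
      rw [Finset.coe_filter, Set.mem_setOf_eq, hmem, Fin.sum_univ_succ]
      refine ⟨⟨?_, fun i => ?_⟩, by simp only [Finsupp.cons_zero]⟩
      · simp only [Finsupp.cons_zero, Finsupp.cons_succ]; omega
      · refine Fin.cases ?_ (fun i => ?_) i
        · rw [Finsupp.cons_zero]; omega
        · rw [Finsupp.cons_succ]; exact hle i
    · rw [Finset.coe_filter, Set.mem_setOf_eq] at hβ
      show Finsupp.cons j (Finsupp.tail β) = β
      rw [← hβ.2, Finsupp.cons_tail]
  · refine Finset.card_eq_zero.mpr (Finset.filter_eq_empty_iff.mpr fun β hβ hβ0 => hjt ?_)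
    obtain ⟨hsum, -⟩ := (hmem _ _ _ β).mp hβ
    have h0 : β 0 ≤ ∑ i, β i := Finset.single_le_sum (f := fun i => β i) (fun i _ => Nat.zero_le _)
      (Finset.mem_univ 0)
    omega

/-- **The box count is `ciHilbert`**: `#{β ∈ ℕ^m : |β| = t, β_i ≤ a_i − 1} = ciHilbert [a₀, …, a_{m−1}] t` for
positive bounds `a_i` — the combinatorial definition of the tree file `Kloosterman2023/CompleteIntersectionHodgeLoci`
("the number of exponent vectors `α` with `Σ αᵢ = m` and `αᵢ < aᵢ` … computed by peeling off the first variable")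
agrees with the Finset count used for Hilbert functions. [cite: Kloosterman2023, §2 eq. (1)] -/
theorem card_filter_finsuppAntidiag_eq_ciHilbert :
    ∀ {m : ℕ} (a : Fin m → ℕ) (_ : ∀ i, 0 < a i) (t : ℕ),
      ((Finset.univ.finsuppAntidiag t).filter fun β : Fin m →₀ ℕ => ∀ i, β i ≤ a i - 1).card =
        ciHilbert (List.ofFn a) t
  | 0, a, _, t => by rw [card_box_zero, List.ofFn_zero, ciHilbert_nil]
  | m + 1, a, ha, t => by
    rw [card_box_succ a (ha 0) t, List.ofFn_succ, ciHilbert_cons, sum_map_range_eq]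
    refine Finset.sum_congr rfl fun j _ => ?_
    split_ifs with hjt
    · exact card_filter_finsuppAntidiag_eq_ciHilbert (fun i => a i.succ) (fun i => ha i.succ) (t - j)
    · rfl

/-! ### `h_I = ciHilbert` for every Artinian complete intersection -/

/-- **The Hilbert function of an Artinian complete intersection is `ciHilbert` of its multidegree** (Kloosterman,
§2 eq. (1): `h_I` depends only on the degrees; Movasati's `C_{d}`): for `m` forms `G_i` of positive degrees
`d_i` in `m` variables with a power of every variable in `(G)` (equivalently `S/(G)` finite-dimensional, or the
`G_i` an `S`-regular sequence — `CompleteIntersectionHilbertFunction.lean`),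
`dim_K S_t − dim_K (G)_t = ciHilbert [d₀, …, d_{m−1}] t`. [cite: Kloosterman2023, §2 eq. (1)]
[cite: Movasati2016Periods, §6] -/
theorem hilbert_span_eq_ciHilbert (G : Fin m → MvPolynomial (Fin m) K) (d : Fin m → ℕ)
    (hG : ∀ i, (G i).IsHomogeneous (d i)) (hd : ∀ i, 0 < d i) {N : ℕ}
    (hXN : ∀ i, (X i : MvPolynomial (Fin m) K) ^ N ∈ Ideal.span (Set.range G)) (t : ℕ) :
    finrank K (homogeneousSubmodule (Fin m) K t) - finrank K (idealDegree (Ideal.span (Set.range G)) t) =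
      ciHilbert (List.ofFn d) t := by
  rw [hilbert_span_eq_card_of_degrees G d hG hd hXN t]
  exact card_filter_finsuppAntidiag_eq_ciHilbert d hd t

/-- The monomial complete intersection: `dim_K (S/(x_i^{a_i}))_t = ciHilbert [a₀, …, a_{m−1}] t`.
[cite: Kloosterman2023, §2 eq. (1)] -/
theorem hilbert_span_X_pow_eq_ciHilbert (a : Fin m → ℕ) (ha : ∀ i, 0 < a i) (t : ℕ) :
    finrank K (homogeneousSubmodule (Fin m) K t) -
        finrank K (idealDegree (Ideal.span (Set.range fun i : Fin m => (X i : MvPolynomial (Fin m) K) ^ a i)) t) =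
      ciHilbert (List.ofFn a) t := by
  rw [hilbert_span_X_pow_eq_card_of_degrees a ha t]
  exact card_filter_finsuppAntidiag_eq_ciHilbert a ha t

/-- **`ciHilbert` of positive degrees is invariant under permutations of the degrees** (it is the Hilbert function
of `(x_i^{a_i})`, which does not see the order of the generators). [cite: Kloosterman2023, §2 eq. (1)] -/
theorem ciHilbert_ofFn_comp_equiv (a : Fin m → ℕ) (ha : ∀ i, 0 < a i) (σ : Equiv.Perm (Fin m)) (t : ℕ) :
    ciHilbert (List.ofFn (a ∘ σ)) t = ciHilbert (List.ofFn a) t := by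
  have hspan : Ideal.span (Set.range fun i : Fin m => (X (σ i) : MvPolynomial (Fin m) ℚ) ^ a (σ i)) =
      Ideal.span (Set.range fun i : Fin m => (X i : MvPolynomial (Fin m) ℚ) ^ a i) := by
    congr 1
    ext p
    constructor
    · rintro ⟨i, rfl⟩; exact ⟨σ i, rfl⟩
    · rintro ⟨i, rfl⟩; exact ⟨σ.symm i, by simp⟩
  have h1 := hilbert_span_eq_ciHilbert (K := ℚ) (fun i : Fin m => (X (σ i) : MvPolynomial (Fin m) ℚ) ^ a (σ i))
    (a ∘ σ) (fun i => isHomogeneous_X_pow (σ i) (a (σ i))) (fun i => ha (σ i)) (N := ∑ j, a j)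
    (fun i => by
      rw [hspan]
      exact (Ideal.span _).pow_mem_of_pow_mem (Ideal.subset_span ⟨i, rfl⟩)
        (Finset.single_le_sum (f := a) (fun j _ => Nat.zero_le _) (Finset.mem_univ i))) t
  rw [hspan, hilbert_span_X_pow_eq_ciHilbert a ha t] at h1
  exact h1.symm

/-- **Gorenstein symmetry of `ciHilbert`**: `ciHilbert a t = ciHilbert a (Σ (a_i − 1) − t)` for `t ≤ Σ (a_i − 1)` and
positive `a_i` — the Hilbert function of the Artinian Gorenstein ideal `(x_i^{a_i})` (socle degree `Σ (a_i − 1)`,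
Macaulay) is symmetric (the tree checks instances by `decide`: `socle_…` in `Kloosterman2023/…`).
[cite: Kloosterman2023, §4] [cite: VoisinHodgeII2003, Thm. 6.19] -/
theorem ciHilbert_ofFn_symm (a : Fin m → ℕ) (ha : ∀ i, 0 < a i) {t u : ℕ} (htu : t + u = ∑ i, (a i - 1)) :
    ciHilbert (List.ofFn a) t = ciHilbert (List.ofFn a) u := by
  have hAG : IsArtinianGorenstein
      (Ideal.span (Set.range fun i : Fin m => (X i : MvPolynomial (Fin m) ℚ) ^ a i)) (∑ i, (a i - 1)) :=
    isArtinianGorenstein_span_of_X_pow_mem (K := ℚ) (fun i => X i ^ a i) a (fun i => isHomogeneous_X_pow i (a i))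
      ha (N := ∑ j, a j + 1) (by omega) fun i => (Ideal.span _).pow_mem_of_pow_mem (Ideal.subset_span ⟨i, rfl⟩)
        ((Finset.single_le_sum (f := a) (fun j _ => Nat.zero_le _) (Finset.mem_univ i)).trans (Nat.le_succ _))
  rw [← hilbert_span_X_pow_eq_ciHilbert (K := ℚ) a ha t, ← hilbert_span_X_pow_eq_ciHilbert (K := ℚ) a ha u]
  exact hAG.hilbert_symm htu

/-- **Cor. 6.20 (i) for every Artinian Gorenstein ideal** `I ⊂ K[x_0, …, x_{m−1}]` of socle degree `σ`:
`(S/I)_k ≠ 0 ⟺ k ≤ σ` (for `k > σ`, `I_k = S_k` by definition; for `k ≤ σ`, `I_k = S_k` would force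
`I_σ ⊇ S_k · S_{σ−k} = S_σ`, contradicting `dim (S/I)_σ = 1`). [cite: VoisinHodgeII2003, Cor. 6.20 (i)]
[cite: DuqueFrancoVillaflor2025Join, Definition 2.1] -/
theorem _root_.Literature.AlgebraicGeometry.DuqueFrancoVillaflor2025.IsArtinianGorenstein.hilbert_pos_iff
    {I : Ideal (MvPolynomial (Fin m) K)} {σ : ℕ} (h : IsArtinianGorenstein I σ) {k : ℕ} :
    0 < finrank K (homogeneousSubmodule (Fin m) K k) - finrank K (idealDegree I k) ↔ k ≤ σ := by
  constructor
  · intro hk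
    by_contra hlt
    rw [h.idealDegree_eq_of_lt (lt_of_not_ge hlt), Nat.sub_self] at hk
    exact lt_irrefl 0 hk
  · intro hk
    have htop := h.hilbert_top
    by_contra hzero
    haveI := finite_homogeneousSubmodule (K := K) (σ := Fin m) k
    have hIk : idealDegree I k = homogeneousSubmodule (Fin m) K k :=
      Submodule.eq_of_le_of_finrank_le (idealDegree_le_homogeneousSubmodule _ k) (by omega)
    have hIσ : idealDegree I σ = homogeneousSubmodule (Fin m) K σ := by
      refine le_antisymm (idealDegree_le_homogeneousSubmodule _ _) fun f hf => ⟨?_, hf⟩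
      have hsplit : homogeneousSubmodule (Fin m) K σ =
          homogeneousSubmodule (Fin m) K k * homogeneousSubmodule (Fin m) K (σ - k) := by
        rw [← homogeneousSubmodule_one_pow (σ := Fin m) (R := K) (n := σ),
          ← homogeneousSubmodule_one_pow (σ := Fin m) (R := K) (n := k),
          ← homogeneousSubmodule_one_pow (σ := Fin m) (R := K) (n := σ - k), ← pow_add,
          Nat.add_sub_cancel' hk]
      rw [hsplit] at hf
      refine Submodule.mul_induction_on hf (fun a ha b _ => ?_) fun x y hx hy => Ideal.add_mem _ hx hy
      have haI : a ∈ idealDegree I k := by rw [hIk]; exact ha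
      exact Ideal.mul_mem_right _ _ haI.1
    rw [hIσ, Nat.sub_self] at htop
    exact zero_ne_one htop

/-- **`ciHilbert a t > 0 ⟺ t ≤ Σ (a_i − 1)`** (positive `a_i`): the socle degree of the monomial complete
intersection (Macaulay; Voisin II Cor. 6.20 (i)); with `ciHilbert a (Σ (a_i − 1)) = 1` (`ciHilbert_ofFn_socle`) this
is the "socle degree `(k+1)e − 2k − 2`" bookkeeping of Kloosterman §4, for all multidegrees at once.
[cite: VoisinHodgeII2003, Cor. 6.20 (i)] [cite: Kloosterman2023, §4] -/
theorem ciHilbert_ofFn_pos_iff (a : Fin m → ℕ) (ha : ∀ i, 0 < a i) {t : ℕ} :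
    0 < ciHilbert (List.ofFn a) t ↔ t ≤ ∑ i, (a i - 1) := by
  have hAG : IsArtinianGorenstein
      (Ideal.span (Set.range fun i : Fin m => (X i : MvPolynomial (Fin m) ℚ) ^ a i)) (∑ i, (a i - 1)) :=
    isArtinianGorenstein_span_of_X_pow_mem (K := ℚ) (fun i => X i ^ a i) a (fun i => isHomogeneous_X_pow i (a i))
      ha (N := ∑ j, a j + 1) (by omega) fun i => (Ideal.span _).pow_mem_of_pow_mem (Ideal.subset_span ⟨i, rfl⟩)
        ((Finset.single_le_sum (f := a) (fun j _ => Nat.zero_le _) (Finset.mem_univ i)).trans (Nat.le_succ _))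
  rw [← hilbert_span_X_pow_eq_ciHilbert (K := ℚ) a ha t]
  exact hAG.hilbert_pos_iff

/-- **`ciHilbert a (Σ (a_i − 1)) = 1`**: the socle of the monomial complete intersection is one-dimensional
(spanned by `Π x_i^{a_i − 1}`). [cite: VoisinHodgeII2003, Thm. 6.19] [cite: Kloosterman2023, §4] -/
theorem ciHilbert_ofFn_socle (a : Fin m → ℕ) (ha : ∀ i, 0 < a i) :
    ciHilbert (List.ofFn a) (∑ i, (a i - 1)) = 1 := by
  have hAG : IsArtinianGorenstein
      (Ideal.span (Set.range fun i : Fin m => (X i : MvPolynomial (Fin m) ℚ) ^ a i)) (∑ i, (a i - 1)) :=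
    isArtinianGorenstein_span_of_X_pow_mem (K := ℚ) (fun i => X i ^ a i) a (fun i => isHomogeneous_X_pow i (a i))
      ha (N := ∑ j, a j + 1) (by omega) fun i => (Ideal.span _).pow_mem_of_pow_mem (Ideal.subset_span ⟨i, rfl⟩)
        ((Finset.single_le_sum (f := a) (fun j _ => Nat.zero_le _) (Finset.mem_univ i)).trans (Nat.le_succ _))
  rw [← hilbert_span_X_pow_eq_ciHilbert (K := ℚ) a ha]
  exact hAG.hilbert_top

open Literature.AlgebraicGeometry.Motives.UniversalHypersurface

/-- **`dim R^F_a = ciHilbert [d−1, …, d−1] a`** (`N+1` entries) for every form `F` of degree `d ≥ 2` in `N + 1`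
variables with finite-dimensional Jacobian ring — Movasati's `#I_a = C_{(d−1)^{n+2}}` for every smooth
hypersurface, as the computable count of the tree's tables. [cite: Movasati2016Periods, §6]
[cite: Kloosterman2023, §2 eq. (1)] -/
theorem hilbert_jacobianIdeal_eq_ciHilbert_of_finite {N d : ℕ} {F : MvPolynomial (Fin (N + 1)) K}
    (hF : F.IsHomogeneous d) (hd : 2 ≤ d) [Module.Finite K (MvPolynomial (Fin (N + 1)) K ⧸ jacobianIdeal F)]
    (a : ℕ) :
    finrank K (homogeneousSubmodule (Fin (N + 1)) K a) - finrank K (idealDegree (jacobianIdeal F) a) =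
      ciHilbert (List.replicate (N + 1) (d - 1)) a := by
  rw [hilbert_jacobianIdeal_eq_card_of_finite hF hd a, ← List.ofFn_const,
    ← card_filter_finsuppAntidiag_eq_ciHilbert (fun _ : Fin (N + 1) => d - 1) (fun _ => by omega) a,
    show d - 1 - 1 = d - 2 by omega]

/-! ### Prop. 4.13: the codimension of `(J^F : det)_t = ((f) + (g))_t` is `ciHilbert (a ++ b) t` -/

section CI

variable {k : ℕ}

/-- `2k + 2 = (k+1) + (k+1)`, for indexing the concatenated family. [folklore] -/
private theorem two_mul_add_two' (k : ℕ) : 2 * k + 2 = (k + 1) + (k + 1) := by omega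

/-- The concatenated family generates `(f) + (g)`. [folklore] -/
private theorem span_range_append_cast' (f g : Fin (k + 1) → MvPolynomial (Fin (2 * k + 2)) K) :
    Ideal.span (Set.range fun l : Fin (2 * k + 2) => Fin.append f g (Fin.cast (two_mul_add_two' k) l)) =
      Ideal.span (Set.range f) ⊔ Ideal.span (Set.range g) := by
  rw [← Ideal.span_union]
  congr 1
  ext x
  constructor
  · rintro ⟨l, rfl⟩
    refine Fin.addCases (motive := fun l' : Fin ((k + 1) + (k + 1)) =>
      Fin.append f g l' ∈ Set.range f ∪ Set.range g) (fun i => ?_) (fun i => ?_)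
      (Fin.cast (two_mul_add_two' k) l)
    · rw [Fin.append_left]; exact Or.inl ⟨i, rfl⟩
    · rw [Fin.append_right]; exact Or.inr ⟨i, rfl⟩
  · rintro (⟨i, rfl⟩ | ⟨i, rfl⟩)
    · exact ⟨Fin.cast (two_mul_add_two' k).symm (Fin.castAdd (k + 1) i), by
        simp only [Fin.cast_cast, Fin.cast_eq_self, Fin.append_left]⟩
    · exact ⟨Fin.cast (two_mul_add_two' k).symm (Fin.natAdd (k + 1) i), by
        simp only [Fin.cast_cast, Fin.cast_eq_self, Fin.append_right]⟩

/-- **The Hilbert function of `(f_0, …, f_k, g_0, …, g_k)`** (an Artinian complete intersection of `2k+2` forms of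
positive degrees `a_i`, `b_i` in `2k+2` variables): `dim_K S_t − dim_K ((f)+(g))_t = ciHilbert (a ++ b) t`
(Kloosterman, before Prop. 4.13: "`S/I` … its Hilbert function depends only on the degrees").
[cite: Kloosterman2023, §2 eq. (1)] [cite: Kloosterman2023, Prop. 4.13] -/
theorem hilbert_span_sup_span_eq_ciHilbert (f g : Fin (k + 1) → MvPolynomial (Fin (2 * k + 2)) K)
    (a b : Fin (k + 1) → ℕ) (hf : ∀ i, (f i).IsHomogeneous (a i)) (hg : ∀ i, (g i).IsHomogeneous (b i))
    (ha : ∀ i, 0 < a i) (hb : ∀ i, 0 < b i) {N : ℕ}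
    (hXN : ∀ j, (X j : MvPolynomial (Fin (2 * k + 2)) K) ^ N ∈ Ideal.span (Set.range f) ⊔ Ideal.span (Set.range g))
    (t : ℕ) :
    finrank K (homogeneousSubmodule (Fin (2 * k + 2)) K t) -
        finrank K (idealDegree (Ideal.span (Set.range f) ⊔ Ideal.span (Set.range g)) t) =
      ciHilbert (List.ofFn a ++ List.ofFn b) t := by
  set H : Fin (2 * k + 2) → MvPolynomial (Fin (2 * k + 2)) K :=
    fun l => Fin.append f g (Fin.cast (two_mul_add_two' k) l) with hH
  set e : Fin (2 * k + 2) → ℕ := fun l => Fin.append a b (Fin.cast (two_mul_add_two' k) l) with he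
  have hHhom : ∀ l, (H l).IsHomogeneous (e l) := by
    intro l
    refine Fin.addCases (motive := fun l' : Fin ((k + 1) + (k + 1)) =>
      (Fin.append f g l').IsHomogeneous (Fin.append a b l')) (fun i => ?_) (fun i => ?_)
      (Fin.cast (two_mul_add_two' k) l)
    · rw [Fin.append_left, Fin.append_left]; exact hf i
    · rw [Fin.append_right, Fin.append_right]; exact hg i
  have hepos : ∀ l, 0 < e l := by
    intro l
    refine Fin.addCases (motive := fun l' : Fin ((k + 1) + (k + 1)) => 0 < Fin.append a b l')
      (fun i => ?_) (fun i => ?_) (Fin.cast (two_mul_add_two' k) l)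
    · rw [Fin.append_left]; exact ha i
    · rw [Fin.append_right]; exact hb i
  have hspan : Ideal.span (Set.range H) = Ideal.span (Set.range f) ⊔ Ideal.span (Set.range g) :=
    span_range_append_cast' f g
  have h1 := hilbert_span_eq_ciHilbert H e hHhom hepos (N := N) (fun j => by rw [hspan]; exact hXN j) t
  rw [hspan] at h1
  rw [h1, he, ← List.ofFn_fin_append, List.ofFn_congr (two_mul_add_two' k).symm (Fin.append a b)]

/-- The Jacobian ideal of `F = Σ f_i g_i` lies in `(f) + (g)`. [folklore] -/
private theorem jacobianIdeal_sum_mul_le (f g : Fin (k + 1) → MvPolynomial (Fin (2 * k + 2)) K) :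
    jacobianIdeal (∑ i, f i * g i) ≤ Ideal.span (Set.range f) ⊔ Ideal.span (Set.range g) := by
  refine Ideal.span_le.mpr ?_
  rintro _ ⟨j, rfl⟩
  show pderiv j (∑ i, f i * g i) ∈ Ideal.span (Set.range f) ⊔ Ideal.span (Set.range g)
  rw [map_sum]
  refine Ideal.sum_mem _ fun i _ => ?_
  rw [pderiv_mul]
  refine Ideal.add_mem _ (Ideal.mem_sup_right (Ideal.mul_mem_left _ _ (Ideal.subset_span ⟨i, rfl⟩)))
    (Ideal.mem_sup_left (Ideal.mul_mem_right _ _ (Ideal.subset_span ⟨i, rfl⟩)))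

/-- **Kloosterman 2023, Prop. 4.13 (algebraic form): the codimension of `(J^F : D)_t` in `S_t` is `h_I(t) =
ciHilbert (a ++ b) t`.** For `F = Σ_{i=0}^{k} f_i g_i` in the `2k+2` variables `x_0, …, x_{2k+1}` (`f_i`, `g_i`
forms of positive degrees `a_i`, `b_i`, `a_i + b_i = d`) with finite-dimensional Jacobian ring, and
`D = det(∂(g, f)/∂x)` (`ciTransitionMatrix`), `(J^F : D) = (f) + (g)` (`det_ciTransitionMatrix_notMem_and_colon_eq`)
and `dim_K S_t − dim_K (J^F : D)_t = ciHilbert (a ++ b) t`. With `[Z]_prim` represented by `c · D` (Villaflor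
2022, Thm. 1) and `T_Y NL(λ) = (J^{F,λ})_e`, the case `t = d = e` is the printed "the codimension in `S_e` of
the tangent space to `NL([Z]_prim)` at `Y` equals `h_I(e)`" (those two identifications are not formalised here).
[cite: Kloosterman2023, Prop. 4.13] [cite: Villaflorloyola2021, Example 2.1] [cite: Villaflor2022PeriodsCI, Thm. 1] -/
theorem hilbert_jacobianIdeal_colon_det_eq_ciHilbert {d : ℕ} (f g : Fin (k + 1) → MvPolynomial (Fin (2 * k + 2)) K)
    (a b : Fin (k + 1) → ℕ) (hf : ∀ i, (f i).IsHomogeneous (a i)) (hg : ∀ i, (g i).IsHomogeneous (b i))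
    (ha : ∀ i, 0 < a i) (hb : ∀ i, 0 < b i) (hab : ∀ i, a i + b i = d) {N : ℕ} (hN : 0 < N)
    (hXN : ∀ j, (X j : MvPolynomial (Fin (2 * k + 2)) K) ^ N ∈ jacobianIdeal (∑ i, f i * g i)) (t : ℕ) :
    finrank K (homogeneousSubmodule (Fin (2 * k + 2)) K t) -
        finrank K (idealDegree
          ((jacobianIdeal (∑ i, f i * g i)).colon {(ciTransitionMatrix f g).det}) t) =
      ciHilbert (List.ofFn a ++ List.ofFn b) t := by
  rw [(det_ciTransitionMatrix_notMem_and_colon_eq f g a b hf hg ha hb hab hN hXN).2]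
  exact hilbert_span_sup_span_eq_ciHilbert f g a b hf hg ha hb (fun j => jacobianIdeal_sum_mul_le f g (hXN j)) t

/-- The same with the hypothesis `Module.Finite K (S ⧸ J^F)` (every smooth hypersurface).
[cite: Kloosterman2023, Prop. 4.13] -/
theorem hilbert_jacobianIdeal_colon_det_eq_ciHilbert_of_finite {d : ℕ}
    (f g : Fin (k + 1) → MvPolynomial (Fin (2 * k + 2)) K)
    (a b : Fin (k + 1) → ℕ) (hf : ∀ i, (f i).IsHomogeneous (a i)) (hg : ∀ i, (g i).IsHomogeneous (b i))
    (ha : ∀ i, 0 < a i) (hb : ∀ i, 0 < b i) (hab : ∀ i, a i + b i = d)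
    [Module.Finite K (MvPolynomial (Fin (2 * k + 2)) K ⧸ jacobianIdeal (∑ i, f i * g i))] (t : ℕ) :
    finrank K (homogeneousSubmodule (Fin (2 * k + 2)) K t) -
        finrank K (idealDegree
          ((jacobianIdeal (∑ i, f i * g i)).colon {(ciTransitionMatrix f g).det}) t) =
      ciHilbert (List.ofFn a ++ List.ofFn b) t := by
  have hF : (∑ i, f i * g i).IsHomogeneous d :=
    IsHomogeneous.sum _ _ _ fun i _ => by rw [← hab i]; exact (hf i).mul (hg i)
  have hIhom : (jacobianIdeal (∑ i, f i * g i)).IsHomogeneous (homogeneousSubmodule (Fin (2 * k + 2)) K) :=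
    Ideal.homogeneous_span _ _ (by rintro _ ⟨i, rfl⟩; exact ⟨d - 1, hF.pderiv⟩)
  choose M hM0 hM using exists_X_pow_mem_of_finite hIhom (m := 2 * k + 2)
  refine hilbert_jacobianIdeal_colon_det_eq_ciHilbert f g a b hf hg ha hb hab (N := ∑ i, M i + 1) (by omega)
    (fun j => (jacobianIdeal _).pow_mem_of_pow_mem (hM j) ?_) t
  have := Finset.single_le_sum (f := M) (fun j _ => Nat.zero_le _) (Finset.mem_univ j)
  omega

/-- **Census instance (Movasati: "`Σ_{1,1,2}` has codimension `8`" in the quartic fourfold; tree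
`movasati_quarticFourfold_sigma112 : ciLocusCodim [1,1,2] 4 = 8`).** For every quartic `F = f₀g₀ + f₁g₁ + f₂g₂`
in `6` variables through a complete intersection `Z = {f = 0}` of type `(1,1,2)` (`g` of type `(3,3,2)`) with
finite-dimensional Jacobian ring: `dim_K S_4 − dim_K (J^F : D)_4 = 8`. [cite: Movasati2016Periods, §6]
[cite: Kloosterman2023, Prop. 4.13] -/
theorem hilbert_jacobianIdeal_colon_det_quarticFourfold_ci112
    (f g : Fin (2 + 1) → MvPolynomial (Fin (2 * 2 + 2)) K)
    (hf : ∀ i, (f i).IsHomogeneous ((![1, 1, 2] : Fin 3 → ℕ) i))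
    (hg : ∀ i, (g i).IsHomogeneous ((![3, 3, 2] : Fin 3 → ℕ) i))
    [Module.Finite K (MvPolynomial (Fin (2 * 2 + 2)) K ⧸ jacobianIdeal (∑ i, f i * g i))] :
    finrank K (homogeneousSubmodule (Fin (2 * 2 + 2)) K 4) -
        finrank K (idealDegree
          ((jacobianIdeal (∑ i, f i * g i)).colon {(ciTransitionMatrix f g).det}) 4) = 8 := by
  rw [hilbert_jacobianIdeal_colon_det_eq_ciHilbert_of_finite f g ![1, 1, 2] ![3, 3, 2] hf hg
    (fun i => by fin_cases i <;> simp) (fun i => by fin_cases i <;> simp) (d := 4)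
    (fun i => by fin_cases i <;> simp)]
  decide

/-! ### Kloosterman's order of the degrees: `ciLocusCodim` -/

/-- Reversing `List.ofFn`. [folklore] -/
private theorem reverse_ofFn' {α : Type*} {n : ℕ} (c : Fin n → α) :
    (List.ofFn c).reverse = List.ofFn (c ∘ Fin.rev) := by
  apply List.ext_getElem
  · simp
  · intro i h₁ h₂
    rw [List.getElem_reverse, List.getElem_ofFn, List.getElem_ofFn, Function.comp_apply]
    congr 1
    ext
    simp only [Fin.val_rev, List.length_ofFn]
    omega

/-- **`ciHilbert (a ++ b) e = ciLocusCodim a e`** when `a_i + b_i = e`: the tree's `ciLocusCodim d e = h_I(e)` for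
`I` of multidegree `propIdealDegrees d e = (d₁,…,d_{k+1},e−d_{k+1},…,e−d₁)` (Kloosterman's order, Prop. 3.2 /
Prop. 4.13) is `ciHilbert` of the concatenated degrees `(a, b)` in the order of the presentation `F = Σ f_i g_i`
(permutation invariance, `ciHilbert_ofFn_comp_equiv`). [cite: Kloosterman2023, Prop. 3.2] -/
theorem ciHilbert_append_eq_ciLocusCodim (a b : Fin (k + 1) → ℕ) (ha : ∀ i, 0 < a i) (hb : ∀ i, 0 < b i)
    {e : ℕ} (hab : ∀ i, a i + b i = e) :
    ciHilbert (List.ofFn a ++ List.ofFn b) e = ciLocusCodim (List.ofFn a) e := by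
  -- Kloosterman's list is `ofFn (Fin.append a (b ∘ rev))`
  have hcomp : ((fun x => e - x) ∘ (a ∘ Fin.rev)) = b ∘ Fin.rev := by
    funext i
    simp only [Function.comp_apply]
    have := hab (Fin.rev i)
    omega
  have h1 : propIdealDegrees (List.ofFn a) e = List.ofFn (Fin.append a (b ∘ Fin.rev)) := by
    rw [propIdealDegrees, reverse_ofFn', List.map_ofFn, hcomp, List.ofFn_fin_append]
  -- which is `ofFn (Fin.append a b ∘ σ)` for the permutation reversing the second block
  set σ : Equiv.Perm (Fin ((k + 1) + (k + 1))) :=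
    finSumFinEquiv.symm.trans ((Equiv.sumCongr (Equiv.refl (Fin (k + 1))) Fin.revPerm).trans finSumFinEquiv)
    with hσ
  have h2 : Fin.append a (b ∘ Fin.rev) = Fin.append a b ∘ σ := by
    funext l
    refine Fin.addCases (motive := fun l => Fin.append a (b ∘ Fin.rev) l = (Fin.append a b ∘ σ) l)
      (fun i => ?_) (fun i => ?_) l
    · rw [Fin.append_left, Function.comp_apply, hσ, Equiv.trans_apply, Equiv.trans_apply,
        finSumFinEquiv_symm_apply_castAdd, Equiv.sumCongr_apply, Sum.map_inl, finSumFinEquiv_apply_left]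
      rw [Fin.append_left]
      rfl
    · rw [Fin.append_right, Function.comp_apply, Function.comp_apply, hσ, Equiv.trans_apply, Equiv.trans_apply,
        finSumFinEquiv_symm_apply_natAdd, Equiv.sumCongr_apply, Sum.map_inr, finSumFinEquiv_apply_right,
        Fin.append_right, Fin.revPerm_apply]
  have hpos : ∀ l, 0 < Fin.append a b l := fun l =>
    Fin.addCases (motive := fun l => 0 < Fin.append a b l) (fun i => by rw [Fin.append_left]; exact ha i)
      (fun i => by rw [Fin.append_right]; exact hb i) l
  rw [ciLocusCodim, h1, h2, ciHilbert_ofFn_comp_equiv (Fin.append a b) hpos σ e, List.ofFn_fin_append]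

/-- **Kloosterman 2023, Prop. 4.13, in the tree's names**: for `F = Σ_{i=0}^{k} f_i g_i` in `2k+2` variables
(`f_i`, `g_i` forms of positive degrees `a_i + b_i = e`) with finite-dimensional Jacobian ring (every smooth `Y` of
degree `e` in `𝐏^{2k+1}` containing the complete intersection `Z = {f = 0}` of multidegree `(a_0, …, a_k)`), and
`D = det(∂(g,f)/∂x)`: `dim_K S_e − dim_K (J^F : D)_e = ciLocusCodim [a_0, …, a_k] e` — "the codimension in `S_e`
of the tangent space to `NL([Z]_prim)` at `Y` equals `h_I(e)`", `I` of multidegree `(d₁,…,d_{k+1},e−d_{k+1},…,e−d₁)`,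
granted `[Z]_prim ↔ c·D` (Villaflor 2022, Thm. 1) and `T_Y NL = (J^{F,λ})_e` (not formalised here).
[cite: Kloosterman2023, Prop. 4.13] [cite: Kloosterman2023, Prop. 3.2] [cite: Villaflor2022PeriodsCI, Thm. 1] -/
theorem hilbert_jacobianIdeal_colon_det_eq_ciLocusCodim_of_finite {e : ℕ}
    (f g : Fin (k + 1) → MvPolynomial (Fin (2 * k + 2)) K)
    (a b : Fin (k + 1) → ℕ) (hf : ∀ i, (f i).IsHomogeneous (a i)) (hg : ∀ i, (g i).IsHomogeneous (b i))
    (ha : ∀ i, 0 < a i) (hb : ∀ i, 0 < b i) (hab : ∀ i, a i + b i = e)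
    [Module.Finite K (MvPolynomial (Fin (2 * k + 2)) K ⧸ jacobianIdeal (∑ i, f i * g i))] :
    finrank K (homogeneousSubmodule (Fin (2 * k + 2)) K e) -
        finrank K (idealDegree
          ((jacobianIdeal (∑ i, f i * g i)).colon {(ciTransitionMatrix f g).det}) e) =
      ciLocusCodim (List.ofFn a) e := by
  rw [hilbert_jacobianIdeal_colon_det_eq_ciHilbert_of_finite f g a b hf hg ha hb hab e]
  exact ciHilbert_append_eq_ciLocusCodim a b ha hb hab

/-- Census row Q2/Q5 `(4,4,·)`: quartic fourfold, `Z` of type `(1,2,2)`; measured first-order rank `11` = `ciHilbert` (tree `census_ci_rows`): for every such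
presentation `F = Σ f_i g_i` with finite-dimensional Jacobian ring, `dim_K S_4 − dim_K (J^F : D)_4 = 11`.
[cite: Kloosterman2023, Prop. 4.13] [cite: Movasati2016Periods, §6] -/
theorem hilbert_jacobianIdeal_colon_det_quarticFourfold_ci122
    (f g : Fin (2 + 1) → MvPolynomial (Fin (2 * 2 + 2)) K)
    (hf : ∀ i, (f i).IsHomogeneous ((![1, 2, 2] : Fin (2 + 1) → ℕ) i))
    (hg : ∀ i, (g i).IsHomogeneous ((![3, 2, 2] : Fin (2 + 1) → ℕ) i))
    [Module.Finite K (MvPolynomial (Fin (2 * 2 + 2)) K ⧸ jacobianIdeal (∑ i, f i * g i))] :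
    finrank K (homogeneousSubmodule (Fin (2 * 2 + 2)) K 4) -
        finrank K (idealDegree
          ((jacobianIdeal (∑ i, f i * g i)).colon {(ciTransitionMatrix f g).det}) 4) = 11 := by
  rw [hilbert_jacobianIdeal_colon_det_eq_ciHilbert_of_finite f g ![1, 2, 2] ![3, 2, 2] hf hg
    (fun i => by fin_cases i <;> simp) (fun i => by fin_cases i <;> simp) (d := 4)
    (fun i => by fin_cases i <;> simp)]
  decide

/-- Census row P `(4,5,1)`: quintic fourfold, `Z` of type `(1,1,2)`; measured first-order rank `19` = `ciHilbert` (tree `census_ci_rows`): for every such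
presentation `F = Σ f_i g_i` with finite-dimensional Jacobian ring, `dim_K S_5 − dim_K (J^F : D)_5 = 19`.
[cite: Kloosterman2023, Prop. 4.13] [cite: Movasati2016Periods, §6] -/
theorem hilbert_jacobianIdeal_colon_det_quinticFourfold_ci112
    (f g : Fin (2 + 1) → MvPolynomial (Fin (2 * 2 + 2)) K)
    (hf : ∀ i, (f i).IsHomogeneous ((![1, 1, 2] : Fin (2 + 1) → ℕ) i))
    (hg : ∀ i, (g i).IsHomogeneous ((![4, 4, 3] : Fin (2 + 1) → ℕ) i))
    [Module.Finite K (MvPolynomial (Fin (2 * 2 + 2)) K ⧸ jacobianIdeal (∑ i, f i * g i))] :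
    finrank K (homogeneousSubmodule (Fin (2 * 2 + 2)) K 5) -
        finrank K (idealDegree
          ((jacobianIdeal (∑ i, f i * g i)).colon {(ciTransitionMatrix f g).det}) 5) = 19 := by
  rw [hilbert_jacobianIdeal_colon_det_eq_ciHilbert_of_finite f g ![1, 1, 2] ![4, 4, 3] hf hg
    (fun i => by fin_cases i <;> simp) (fun i => by fin_cases i <;> simp) (d := 5)
    (fun i => by fin_cases i <;> simp)]
  decide

/-- Census row C1 `(6,3,2)`: cubic sixfold, `Z` of type `(1,1,1,2)`; measured first-order rank `4` = `ciHilbert` (tree `census_ci_rows`): for every such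
presentation `F = Σ f_i g_i` with finite-dimensional Jacobian ring, `dim_K S_3 − dim_K (J^F : D)_3 = 4`.
[cite: Kloosterman2023, Prop. 4.13] [cite: Movasati2016Periods, §6] -/
theorem hilbert_jacobianIdeal_colon_det_cubicSixfold_ci1112
    (f g : Fin (3 + 1) → MvPolynomial (Fin (2 * 3 + 2)) K)
    (hf : ∀ i, (f i).IsHomogeneous ((![1, 1, 1, 2] : Fin (3 + 1) → ℕ) i))
    (hg : ∀ i, (g i).IsHomogeneous ((![2, 2, 2, 1] : Fin (3 + 1) → ℕ) i))
    [Module.Finite K (MvPolynomial (Fin (2 * 3 + 2)) K ⧸ jacobianIdeal (∑ i, f i * g i))] :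
    finrank K (homogeneousSubmodule (Fin (2 * 3 + 2)) K 3) -
        finrank K (idealDegree
          ((jacobianIdeal (∑ i, f i * g i)).colon {(ciTransitionMatrix f g).det}) 3) = 4 := by
  rw [hilbert_jacobianIdeal_colon_det_eq_ciHilbert_of_finite f g ![1, 1, 1, 2] ![2, 2, 2, 1] hf hg
    (fun i => by fin_cases i <;> simp) (fun i => by fin_cases i <;> simp) (d := 3)
    (fun i => by fin_cases i <;> simp)]
  decide

/-- Census row E1 `(6,4,1)`: quartic sixfold, `Z` of type `(2,2,1,1)`; measured first-order rank `36` = `ciHilbert` (tree `census_ci_rows`): for every such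
presentation `F = Σ f_i g_i` with finite-dimensional Jacobian ring, `dim_K S_4 − dim_K (J^F : D)_4 = 36`.
[cite: Kloosterman2023, Prop. 4.13] [cite: Movasati2016Periods, §6] -/
theorem hilbert_jacobianIdeal_colon_det_quarticSixfold_ci2211
    (f g : Fin (3 + 1) → MvPolynomial (Fin (2 * 3 + 2)) K)
    (hf : ∀ i, (f i).IsHomogeneous ((![2, 2, 1, 1] : Fin (3 + 1) → ℕ) i))
    (hg : ∀ i, (g i).IsHomogeneous ((![2, 2, 3, 3] : Fin (3 + 1) → ℕ) i))
    [Module.Finite K (MvPolynomial (Fin (2 * 3 + 2)) K ⧸ jacobianIdeal (∑ i, f i * g i))] :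
    finrank K (homogeneousSubmodule (Fin (2 * 3 + 2)) K 4) -
        finrank K (idealDegree
          ((jacobianIdeal (∑ i, f i * g i)).colon {(ciTransitionMatrix f g).det}) 4) = 36 := by
  rw [hilbert_jacobianIdeal_colon_det_eq_ciHilbert_of_finite f g ![2, 2, 1, 1] ![2, 2, 3, 3] hf hg
    (fun i => by fin_cases i <;> simp) (fun i => by fin_cases i <;> simp) (d := 4)
    (fun i => by fin_cases i <;> simp)]
  decide

/-- Census row `(8,4,2)`: quartic eightfold, `Z` of type `(2,2,1,1,1)`; measured first-order rank `83` = `ciHilbert` (tree `census_ci_rows`): for every such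
presentation `F = Σ f_i g_i` with finite-dimensional Jacobian ring, `dim_K S_4 − dim_K (J^F : D)_4 = 83`.
[cite: Kloosterman2023, Prop. 4.13] [cite: Movasati2016Periods, §6] -/
theorem hilbert_jacobianIdeal_colon_det_quarticEightfold_ci22111
    (f g : Fin (4 + 1) → MvPolynomial (Fin (2 * 4 + 2)) K)
    (hf : ∀ i, (f i).IsHomogeneous ((![2, 2, 1, 1, 1] : Fin (4 + 1) → ℕ) i))
    (hg : ∀ i, (g i).IsHomogeneous ((![2, 2, 3, 3, 3] : Fin (4 + 1) → ℕ) i))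
    [Module.Finite K (MvPolynomial (Fin (2 * 4 + 2)) K ⧸ jacobianIdeal (∑ i, f i * g i))] :
    finrank K (homogeneousSubmodule (Fin (2 * 4 + 2)) K 4) -
        finrank K (idealDegree
          ((jacobianIdeal (∑ i, f i * g i)).colon {(ciTransitionMatrix f g).det}) 4) = 83 := by
  rw [hilbert_jacobianIdeal_colon_det_eq_ciHilbert_of_finite f g ![2, 2, 1, 1, 1] ![2, 2, 3, 3, 3] hf hg
    (fun i => by fin_cases i <;> simp) (fun i => by fin_cases i <;> simp) (d := 4)
    (fun i => by fin_cases i <;> simp)]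
  decide

end CI

end Literature.AlgebraicGeometry.HodgeTheory

end
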